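import Literature.Analysis.FluidPDE.AdaptedBackwardKernel
import Literature.Analysis.FluidPDE.DriftHeatKernelLowerBound
import Literature.Analysis.FluidPDE.SpaceTimeCalculus

/-!
# Crux `AdaptedKernelExists` (stmt-NavierStokesRegularity-2956), line `nash-entropy-last-block`:
  the BRIDGE for STUB `stub_lowerOfUpper` (adapted backward kernel ↦ local drift–heat class)

Helper file (lands `--supports stmt-NavierStokesRegularity-2956`) for the registered stub
`stub_lowerOfUpper` of the line's skeleton (Gaussian lower bound on the last block for an adapted
backward kernel `G` of `∂ₜ + b·∇ − νΔ`, `IsAdaptedBackwardKernel ν b (Ico t₀ T) T x₀ G`). This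
file carries the analytic part, for a general finite-dimensional inner product space `E`:

* `lowerOfUpper_continuousOn_fderiv_slice`, `lowerOfUpper_continuousOn_laplacian_slice`: the
  joint-`C²` dictionary at interior times (`D(G t)(x)` and `Δ(G t)(x)` are jointly continuous on
  `S₀ × E`, `S₀` open, when `uncurry G` is `C²` there);
* `lowerOfUpper_bridge`: in the reversed, rescaled time `σ = ν(t + τ − s)` the kernel
  `v(σ, x) = G(t + τ − σ/ν, x)` belongs to the tree's local time-integrated class
  `IsDriftHeatSolutionOn a v (B/ν) (Icc 0 (ντ)) univ` of `v_σ + a·∇v − Δv = 0`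
  (`DriftHeatLocalClass`) with the drift `a = −b/ν`, whenever `‖b‖ ≤ B` on the interior block
  `[t, t + τ] ⊆ (t₀, T)` (adjoint equation with a two-sided time derivative at interior times,
  fundamental theorem of calculus);
* `lowerOfUpper_pointwise`: the tree's Gaussian lower bound by the earlier local mass
  `IsDriftHeatSolutionOn.kernel_lower_bound` (`DriftHeatKernelLowerBound`) on balls
  `B̄(x₀, ρ′)`, `ρ′ → ∞`, gives `(∫ φ) · kSubLow n (B/ν) (‖x − x₀‖ + r_s) (ντ) ≤ G(t, x)` for
  every continuous weight `0 ≤ φ ≤ G(t + τ, ·)` supported in `B̄(x₀, r_s)`.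

Its `ℝ³` form is the registered sub-goal `stub_lowerOfUpper_pointwise` of the crux item. The
companion file `…LowerOfUpper` supplies the mass of the weight, the constants and the stub.
-/

noncomputable section

open MeasureTheory Set Filter Topology Metric Function Real
open scoped Laplacian
open Literature.Analysis.FluidPDE

namespace Summit.NavierStokesRegularity.NavierStokesRegularity.Theorems.AdaptedKernelExists.NashEntropyLastBlock

/-! ### Joint `C²` dictionary at interior times -/

section JointC2

variable {E : Type*} [NormedAddCommGroup E] [InnerProductSpace ℝ E] [FiniteDimensional ℝ E]

omit [FiniteDimensional ℝ E] in
/-- For `G` jointly `C²` on `S₀ × E`, `S₀` open, the slice gradient `(t, x) ↦ D(G t)(x)` is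
jointly continuous there (it is `D(uncurry G)(t, x) ∘ (0, ·)`). -/
theorem lowerOfUpper_continuousOn_fderiv_slice {S₀ : Set ℝ} (hS₀ : IsOpen S₀) {G : ℝ → E → ℝ}
    (hG : ContDiffOn ℝ 2 (uncurry G) (S₀ ×ˢ univ)) :
    ContinuousOn (fun p : ℝ × E => fderiv ℝ (G p.1) p.2) (S₀ ×ˢ univ) := by
  have hO : IsOpen (S₀ ×ˢ (univ : Set E)) := hS₀.prod isOpen_univ
  have h1 : ContinuousOn (fderiv ℝ (uncurry G)) (S₀ ×ˢ univ) :=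
    hG.continuousOn_fderiv_of_isOpen hO (by norm_num)
  refine (h1.clm_comp (continuousOn_const (c := ContinuousLinearMap.inr ℝ ℝ E))).congr ?_
  rintro ⟨t, x⟩ hp
  have hd : HasFDerivAt (uncurry G) (fderiv ℝ (uncurry G) (t, x)) (t, x) :=
    ((hG.differentiableOn (by norm_num)).differentiableAt (hO.mem_nhds hp)).hasFDerivAt
  exact (hasFDerivAt_slice hd).fderiv

/-- For `G` jointly `C²` on `S₀ × E`, `S₀` open, the slice Laplacian `(t, x) ↦ Δ(G t)(x)` is
jointly continuous there (`Δ(G t)(x) = Σᵢ D²(uncurry G)(t, x)(0, eᵢ)(0, eᵢ)`). -/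
theorem lowerOfUpper_continuousOn_laplacian_slice {S₀ : Set ℝ} (hS₀ : IsOpen S₀) {G : ℝ → E → ℝ}
    (hG : ContDiffOn ℝ 2 (uncurry G) (S₀ ×ˢ univ)) :
    ContinuousOn (fun p : ℝ × E => (Δ (G p.1)) p.2) (S₀ ×ˢ univ) := by
  have hO : IsOpen (S₀ ×ˢ (univ : Set E)) := hS₀.prod isOpen_univ
  obtain ⟨H₁, hH₁⟩ : ∃ H₁ : ℝ × E → (ℝ × E →L[ℝ] ℝ), H₁ = fderiv ℝ (uncurry G) := ⟨_, rfl⟩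
  have hH₁c : ContDiffOn ℝ 1 H₁ (S₀ ×ˢ univ) := by
    rw [hH₁]; exact hG.fderiv_of_isOpen hO (by norm_num)
  have hH₂ : ContinuousOn (fderiv ℝ H₁) (S₀ ×ˢ univ) := hH₁c.continuousOn_fderiv_of_isOpen hO le_rfl
  set e := stdOrthonormalBasis ℝ E
  have hD1 : ∀ p ∈ S₀ ×ˢ (univ : Set E), ∀ v, fderiv ℝ (G p.1) p.2 v = H₁ p (0, v) := by
    rintro ⟨t, x⟩ hp v
    have hd : HasFDerivAt (uncurry G) (H₁ (t, x)) (t, x) := by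
      rw [hH₁]
      exact ((hG.differentiableOn (by norm_num)).differentiableAt (hO.mem_nhds hp)).hasFDerivAt
    rw [(hasFDerivAt_slice hd).fderiv]
    simp
  have hD2 : ∀ t ∈ S₀, ∀ x v,
      fderiv ℝ (fun y => fderiv ℝ (G t) y v) x v = fderiv ℝ H₁ (t, x) (0, v) (0, v) := by
    intro t ht x v
    have heq : (fun y => fderiv ℝ (G t) y v) = fun y => H₁ (t, y) (0, v) :=
      funext fun y => hD1 (t, y) ⟨ht, mem_univ y⟩ v
    have hd : HasFDerivAt (uncurry fun s y => H₁ (s, y)) (fderiv ℝ H₁ (t, x)) (t, x) :=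
      ((hH₁c.differentiableOn one_ne_zero).differentiableAt
        (hO.mem_nhds ⟨ht, mem_univ x⟩)).hasFDerivAt
    have hsl : HasFDerivAt (fun y => H₁ (t, y))
        ((fderiv ℝ H₁ (t, x)).comp (ContinuousLinearMap.inr ℝ ℝ E)) x :=
      hasFDerivAt_slice (w := fun s y => H₁ (s, y)) hd
    rw [heq, (hsl.clm_apply (hasFDerivAt_const ((0 : ℝ), v) x)).fderiv]
    simp
  have hsum : ContinuousOn (fun p : ℝ × E => ∑ i, fderiv ℝ H₁ p (0, e i) (0, e i)) (S₀ ×ˢ univ) :=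
    continuousOn_finsetSum _ fun i _ =>
      (hH₂.clm_apply continuousOn_const).clm_apply continuousOn_const
  refine hsum.congr ?_
  rintro ⟨t, x⟩ ⟨ht, -⟩
  have h2 : ContDiff ℝ 2 (G t) := by
    have hc : ContDiff ℝ 2 (fun y : E => ((t, y) : ℝ × E)) := contDiff_const.prodMk contDiff_id
    have := hG.comp_contDiff hc (fun y => mk_mem_prod ht (mem_univ y))
    simpa [Function.comp_def] using this
  show (Δ (G t)) x = ∑ i, fderiv ℝ H₁ (t, x) (0, e i) (0, e i)
  rw [laplacian_eq_sum_fderiv_fderiv e h2 x]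
  exact Finset.sum_congr rfl fun i _ => hD2 t ht x (e i)

end JointC2

/-! ### The bridge to the local drift–heat class and the Gaussian comparison -/

section Bridge

variable {E : Type*} [NormedAddCommGroup E] [InnerProductSpace ℝ E] [FiniteDimensional ℝ E]
  [MeasurableSpace E] [BorelSpace E]

/-- Bookkeeping of the reversed time `s = t + τ − σ/ν`: for `σ ∈ [0, ντ]` it lies in
`[t, t + τ]` and the clamp `max t (min (t + τ) ·)` does nothing. -/
theorem lowerOfUpper_clamp {ν t τ σ : ℝ} (hν : 0 < ν) (hσ : σ ∈ Icc 0 (ν * τ)) :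
    max t (min (t + τ) (t + τ - σ / ν)) = t + τ - σ / ν ∧ t + τ - σ / ν ∈ Icc t (t + τ) := by
  have h1 : 0 ≤ σ / ν := div_nonneg hσ.1 hν.le
  have h2 : σ / ν ≤ τ := by rw [div_le_iff₀ hν]; linarith [hσ.2]
  refine ⟨?_, by linarith, by linarith⟩
  rw [min_eq_right (by linarith), max_eq_right (by linarith)]

/-- **The bridge.** For an adapted backward kernel `G` of `∂ₜ + b·∇ − νΔ` on `Ico t₀ T` and an
interior block `[t, t + τ] ⊆ (t₀, T)` on which `‖b‖ ≤ B`, the reversed and rescaled kernel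
`v(σ, x) = G(t + τ − σ/ν, x)`, `σ ∈ [0, ντ]`, belongs to the tree's local time-integrated class of
`v_σ + a·∇v − Δv = 0` with a measurable drift `a` (`= −b(t + τ − σ/ν)/ν` on the block) bounded by
`B/ν`: slices are `C²`, `D(v σ)`, `Δ(v σ)` are jointly continuous (joint `C²` regularity at
interior times), and `v(σ₂) − v(σ₁) = ∫ (Δv − Dv[a])` by the adjoint equation (a two-sided time
derivative at interior times) and the fundamental theorem of calculus. -/
theorem lowerOfUpper_bridge {ν t₀ T t τ B : ℝ} {b : ℝ → E → E} {x₀ : E} {G : ℝ → E → ℝ}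
    (hν : 0 < ν) (ht : t₀ < t) (hτ : 0 < τ) (htT : t + τ < T)
    (hb : IsSmoothSpaceTimeOn (Ico t₀ T) b) (hB : ∀ s ∈ Icc t (t + τ), ∀ x, ‖b s x‖ ≤ B)
    (hG : IsAdaptedBackwardKernel ν b (Ico t₀ T) T x₀ G) :
    ∃ a : ℝ → E → E,
      IsDriftHeatSolutionOn a (fun σ => G (t + τ - σ / ν)) (B / ν) (Icc 0 (ν * τ)) univ := by
  have hIoo : Icc t (t + τ) ⊆ Ioo t₀ T := fun s hs => ⟨ht.trans_le hs.1, hs.2.trans_lt htT⟩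
  have hIco : Ioo t₀ T ⊆ Ico t₀ T := Ioo_subset_Ico_self
  have hO : IsOpen (Ioo t₀ T ×ˢ (univ : Set E)) := isOpen_Ioo.prod isOpen_univ
  have hG2 : ContDiffOn ℝ 2 (uncurry G) (Ioo t₀ T ×ˢ univ) :=
    hG.contDiffOn.mono (prod_mono hIco Subset.rfl)
  obtain ⟨cl, hcl⟩ : ∃ cl : ℝ → ℝ, cl = fun σ => max t (min (t + τ) (t + τ - σ / ν)) :=
    ⟨_, rfl⟩
  have hclc : Continuous cl := by
    rw [hcl]
    exact continuous_const.max (continuous_const.min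
      (continuous_const.sub (continuous_id.div_const ν)))
  have hclmem : ∀ σ, cl σ ∈ Icc t (t + τ) := fun σ => by
    rw [hcl]
    exact ⟨le_max_left _ _, max_le (by linarith) (min_le_left _ _)⟩
  have hclS : ∀ σ ∈ Icc 0 (ν * τ), cl σ = t + τ - σ / ν := fun σ hσ => by
    rw [hcl]; exact (lowerOfUpper_clamp hν hσ).1
  have hsS : ∀ σ ∈ Icc 0 (ν * τ), t + τ - σ / ν ∈ Icc t (t + τ) := fun σ hσ =>
    (lowerOfUpper_clamp hν hσ).2
  -- the drift
  have hac : Continuous fun p : ℝ × E => -(1 / ν) • b (cl p.1) p.2 := by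
    have h1 : Continuous fun p : ℝ × E => (cl p.1, p.2) := by fun_prop
    have h2 := hb.continuousOn.comp_continuous h1
      (fun p => ⟨hIco (hIoo (hclmem p.1)), mem_univ _⟩)
    exact continuous_const.smul h2
  have hJ1 := lowerOfUpper_continuousOn_fderiv_slice isOpen_Ioo hG2
  have hJ2 := lowerOfUpper_continuousOn_laplacian_slice isOpen_Ioo hG2
  have hmap : Continuous fun p : ℝ × E => (t + τ - p.1 / ν, p.2) := by fun_prop
  have hmaps : MapsTo (fun p : ℝ × E => (t + τ - p.1 / ν, p.2)) (Icc 0 (ν * τ) ×ˢ univ)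
      (Ioo t₀ T ×ˢ univ) := fun p hp => ⟨hIoo (hsS p.1 hp.1), mem_univ _⟩
  have hD : ContinuousOn (fun p : ℝ × E => fderiv ℝ (G (t + τ - p.1 / ν)) p.2)
      (Icc 0 (ν * τ) ×ˢ univ) := by
    have h := hJ1.comp hmap.continuousOn hmaps
    exact h
  have hL : ContinuousOn (fun p : ℝ × E => (Δ (G (t + τ - p.1 / ν))) p.2)
      (Icc 0 (ν * τ) ×ˢ univ) := by
    have h := hJ2.comp hmap.continuousOn hmaps
    exact h
  refine ⟨fun σ x => -(1 / ν) • b (cl σ) x, hac.measurable, ?_, ?_, hD, hL, ?_⟩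
  · intro σ _ x _
    rw [norm_smul, norm_neg, norm_div, norm_one, Real.norm_of_nonneg hν.le]
    calc 1 / ν * ‖b (cl σ) x‖ ≤ 1 / ν * B :=
          mul_le_mul_of_nonneg_left (hB _ (hclmem σ) x) (by positivity)
      _ = B / ν := by ring
  · intro σ hσ
    exact (hG.contDiff_slice (hIco (hIoo (hsS σ hσ)))).contDiffOn
  · intro x _ σ₁ hσ₁ σ₂ hσ₂ h12
    have hsub : uIcc σ₁ σ₂ ⊆ Icc 0 (ν * τ) := by
      rw [uIcc_of_le h12]; exact Icc_subset_Icc hσ₁.1 hσ₂.2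
    have hderiv : ∀ r ∈ uIcc σ₁ σ₂, HasDerivAt (fun r' => G (t + τ - r' / ν) x)
        ((Δ (G (t + τ - r / ν))) x -
          fderiv ℝ (G (t + τ - r / ν)) x (-(1 / ν) • b (cl r) x)) r := by
      intro r hr
      have hrS := hsub hr
      have hs := hIoo (hsS r hrS)
      have hd : HasFDerivAt (uncurry G) (fderiv ℝ (uncurry G) (t + τ - r / ν, x))
          (t + τ - r / ν, x) :=
        ((hG2.differentiableOn (by norm_num)).differentiableAt
          (hO.mem_nhds ⟨hs, mem_univ x⟩)).hasFDerivAt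
      have htl := hasDerivAt_timeLine hd
      have heq := hG.adjoint_eq (t + τ - r / ν) (hIco hs) x
      rw [timeDerivWithin_eq_deriv_of_mem_nhds (Ico_mem_nhds hs.1 hs.2), htl.deriv] at heq
      have hlin : HasDerivAt (fun r' : ℝ => t + τ - r' / ν) (-(1 / ν)) r := by
        simpa using ((hasDerivAt_id r).div_const ν).const_sub (t + τ)
      refine (htl.comp r hlin).congr_deriv ?_
      rw [hclS r hrS, map_smul, smul_eq_mul,
        show fderiv ℝ (uncurry G) (t + τ - r / ν, x) (1, 0) =
          -(fderiv ℝ (G (t + τ - r / ν)) x (b (t + τ - r / ν) x)) -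
            ν * (Δ (G (t + τ - r / ν))) x by linarith]
      field_simp
      ring
    have hcont : ContinuousOn (fun r => (Δ (G (t + τ - r / ν))) x -
        fderiv ℝ (G (t + τ - r / ν)) x (-(1 / ν) • b (cl r) x)) (uIcc σ₁ σ₂) := by
      have h1 := continuousOn_time_slice
        (F := fun p : ℝ × E => (Δ (G (t + τ - p.1 / ν))) p.2) hL (mem_univ x) hsub
      have h2 := continuousOn_time_slice
        (F := fun p : ℝ × E => fderiv ℝ (G (t + τ - p.1 / ν)) p.2) hD (mem_univ x) hsub
      have h3 : Continuous fun r : ℝ => -(1 / ν) • b (cl r) x :=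
        hac.comp (continuous_id.prodMk continuous_const)
      exact h1.sub (h2.clm_apply h3.continuousOn)
    exact (intervalIntegral.integral_eq_sub_of_hasDerivAt hderiv hcont.intervalIntegrable).symm

/-- **Gaussian lower bound at the bottom of an interior block.** In the situation of
`lowerOfUpper_bridge` (`‖b‖ ≤ B` on `[t, t + τ]`, `B ≥ 0`), for every continuous weight
`0 ≤ φ ≤ G(t + τ, ·)` with `tsupport φ ⊆ B̄(x₀, r_s)`, `r_s > 0`, and every `x`:
`(∫ φ) · kSubLow n (B/ν) (‖x − x₀‖ + r_s) (ντ) ≤ G(t, x)` — the tree's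
`IsDriftHeatSolutionOn.kernel_lower_bound` for the reversed kernel on the balls `B̄(x₀, ρ′)`
(positivity of `G` on their boundary), in the limit `ρ′ → ∞` where the boundary correction
`gaussTail n (ρ′ − r_s) (ντ)` vanishes. -/
theorem lowerOfUpper_pointwise {ν t₀ T t τ B rs : ℝ} {b : ℝ → E → E} {x₀ : E} {G : ℝ → E → ℝ}
    {φ : E → ℝ} (hν : 0 < ν) (ht : t₀ < t) (hτ : 0 < τ) (htT : t + τ < T)
    (hb : IsSmoothSpaceTimeOn (Ico t₀ T) b) (hB : ∀ s ∈ Icc t (t + τ), ∀ x, ‖b s x‖ ≤ B)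
    (hB0 : 0 ≤ B) (hG : IsAdaptedBackwardKernel ν b (Ico t₀ T) T x₀ G) (hφ : Continuous φ)
    (h0 : ∀ z, 0 ≤ φ z) (hφG : ∀ z, φ z ≤ G (t + τ) z) (hrs : 0 < rs)
    (hsupp : tsupport φ ⊆ closedBall x₀ rs) (x : E) :
    (∫ z, φ z) * kSubLow (Module.finrank ℝ E) (B / ν) (‖x - x₀‖ + rs) (ν * τ) ≤ G t x := by
  obtain ⟨a, hv⟩ := lowerOfUpper_bridge hν ht hτ htT hb hB hG
  have hστ : 0 < ν * τ := mul_pos hν hτ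
  have hA : 0 ≤ B / ν := div_nonneg hB0 hν.le
  have hN : 0 ≤ (Module.finrank ℝ E : ℝ) := Nat.cast_nonneg _
  have hIco : ∀ σ ∈ Icc 0 (ν * τ), t + τ - σ / ν ∈ Ico t₀ T := fun σ hσ =>
    have h := (lowerOfUpper_clamp hν hσ).2
    ⟨(ht.trans_le h.1).le, h.2.trans_lt htT⟩
  have e1 : t + τ - ν * τ / ν = t := by field_simp; ring
  -- comparison on the balls `B̄(x₀, ρ′)`
  have hev : ∀ᶠ ρ' in atTop, (∫ z, φ z) *
      (kSubLow (Module.finrank ℝ E) (B / ν) (‖x - x₀‖ + rs) (ν * τ) -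
        gaussTail (Module.finrank ℝ E) (ρ' - rs) (ν * τ)) ≤ G t x := by
    filter_upwards [eventually_ge_atTop (max ‖x - x₀‖ (rs + 2 * (Module.finrank ℝ E : ℝ) *
      (ν * τ) + 1))] with ρ' hρ'
    have h1 : ‖x - x₀‖ ≤ ρ' := (le_max_left _ _).trans hρ'
    have h2 : rs + 2 * (Module.finrank ℝ E : ℝ) * (ν * τ) + 1 ≤ ρ' := (le_max_right _ _).trans hρ'
    have hNσ : 0 ≤ 2 * (Module.finrank ℝ E : ℝ) * (ν * τ) := by positivity
    have hd1 : 1 ≤ ρ' - rs := by linarith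
    have hrsρ : rs < ρ' := by linarith
    have hroom : 2 * (Module.finrank ℝ E : ℝ) * (ν * τ - 0) < (ρ' - rs) ^ 2 := by
      have : ρ' - rs ≤ (ρ' - rs) ^ 2 := by nlinarith
      rw [sub_zero]
      linarith
    have key := hv.kernel_lower_bound isOpen_univ hA (c := x₀) hrs hrsρ h1 Subset.rfl
      (subset_univ _) hroom (fun σ hσ z _ => (hG.pos _ (hIco σ hσ) z).le) hφ h0 hsupp
      (fun z _ => by
        show φ z ≤ G (t + τ - 0 / ν) z
        rw [zero_div, sub_zero]
        exact hφG z)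
      (ν * τ) ⟨hστ, le_rfl⟩ x (mem_closedBall.2 (by rw [dist_eq_norm]))
    simpa only [sub_zero, e1] using key
  -- the limit `ρ′ → ∞`
  have hg : Tendsto (fun ρ' : ℝ => gaussTail (Module.finrank ℝ E) (ρ' - rs) (ν * τ)) atTop
      (𝓝 0) := by
    have h1 : Tendsto (fun ρ' : ℝ => ρ' - rs) atTop atTop :=
      tendsto_atTop_atTop.2 fun c => ⟨c + rs, fun a ha => by linarith⟩
    have h2 : Tendsto (fun d : ℝ => Real.exp (-d ^ 2 / (4 * (ν * τ)))) atTop (𝓝 0) := by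
      refine Real.tendsto_exp_atBot.comp ?_
      exact (tendsto_neg_atTop_atBot.comp (tendsto_pow_atTop two_ne_zero)).atBot_div_const
        (by positivity)
    have h3 : Tendsto (fun d : ℝ => gaussTail (Module.finrank ℝ E) d (ν * τ)) atTop (𝓝 0) := by
      have := h2.const_mul ((4 * π * (ν * τ)) ^ (-(Module.finrank ℝ E : ℝ) / 2))
      rw [mul_zero] at this
      exact this
    exact h3.comp h1
  have hlim := (tendsto_const_nhds (x := ∫ z, φ z)).mul
    ((tendsto_const_nhds (x := kSubLow (Module.finrank ℝ E) (B / ν) (‖x - x₀‖ + rs) (ν * τ))).sub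
      hg)
  have := le_of_tendsto hlim hev
  simpa only [sub_zero] using this

/-- **Registered sub-goal `stub_lowerOfUpper_pointwise`** (the `ℝ³` form of
`lowerOfUpper_pointwise`, the comparison half of STUB `stub_lowerOfUpper`): for an adapted
backward kernel `G` of `∂ₜ + b·∇ − νΔ` on `Ico t₀ T`, an interior block `[t, t + τ] ⊆ (t₀, T)`
with `‖b‖ ≤ B` there, and a continuous weight `0 ≤ φ ≤ G(t + τ, ·)` supported in `B̄(x₀, r_s)`:
`(∫ φ) · kSubLow 3 (B/ν) (‖x − x₀‖ + r_s) (ντ) ≤ G(t, x)`. -/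
theorem stub_lowerOfUpper_pointwise :
    ∀ (ν t₀ T t τ B rs : ℝ) (b : ℝ → EuclideanSpace ℝ (Fin 3) → EuclideanSpace ℝ (Fin 3)) (x₀ : EuclideanSpace ℝ (Fin 3)) (G : ℝ → EuclideanSpace ℝ (Fin 3) → ℝ) (φ : EuclideanSpace ℝ (Fin 3) → ℝ), 0 < ν → t₀ < t → 0 < τ → t + τ < T → IsSmoothSpaceTimeOn (Ico t₀ T) b → (∀ s ∈ Icc t (t + τ), ∀ x, ‖b s x‖ ≤ B) → 0 ≤ B → IsAdaptedBackwardKernel ν b (Ico t₀ T) T x₀ G → Continuous φ → (∀ z, 0 ≤ φ z) → (∀ z, φ z ≤ G (t + τ) z) → 0 < rs → tsupport φ ⊆ closedBall x₀ rs → ∀ x, (∫ z, φ z) * kSubLow 3 (B / ν) (‖x - x₀‖ + rs) (ν * τ) ≤ G t x :=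
  fun _ _ _ _ _ _ _ _ _ _ _ hν ht hτ htT hb hB hB0 hG hφ h0 hφG hrs hsupp x => by
    have h := lowerOfUpper_pointwise hν ht hτ htT hb hB hB0 hG hφ h0 hφG hrs hsupp x
    simp only [finrank_euclideanSpace_fin, Nat.cast_ofNat] at h
    exact h

end Bridge

end Summit.NavierStokesRegularity.NavierStokesRegularity.Theorems.AdaptedKernelExists.NashEntropyLastBlock

end
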